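import Summits.QuantumAdvantage.QuantumAdvantage.Theorems.WbwObfuscatedGluedTreesKowPhReduction
import Summits.QuantumAdvantage.QuantumAdvantage.Theorems.WbwObfuscatedGluedTreesKowPhGameReal
import Summits.QuantumAdvantage.QuantumAdvantage.Theorems.WbwObfuscatedGluedTreesKowPhGameIdeal
import Summits.QuantumAdvantage.QuantumAdvantage.Theorems.WbwObfuscatedGluedTreesKowPhBridge
import Summits.QuantumAdvantage.QuantumAdvantage.Theorems.WhiteBoxWalkWbwObfuscatedGluedTreesRealIdealNumeric
import Literature.Computability.Complexity.CodeFP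

/-!
# Line `knowledge-of-walk-split`, STAGE 7 — the PRF HYBRID: black-box clause (C) for the landed generator from the
# pseudorandomness of its scheduled PRF instances (crux `WbwObfuscatedGluedTrees`, stmt-QuantumAdvantage-2340, route
# WhiteBoxWalk; lead prover-line-stmt-QuantumAdvantage-2340-c6-0)

Stage 5 (`blackBoxSoundness_holds`, p143810) and stage 6 (`idealCodeSoundness_holds`, p152587; numeric / asymptotic
companion p152791) bound every computationally unbounded bit-oracle walker in IDEAL MODEL II — the generator's own
naming / Feistel code over four uniformly random `μ`-bit tables — and identify the landed generator's instance with
that code run at the tables of its own four PRF keys (`stub_codeLink`).  Stage 7 removes the last idealisation: the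
four keyed PRF instances `F_{k₁..k₄}` at parameter `μ = Λ.prfParam n` are replaced by uniform tables against
PROBABILISTIC POLYNOMIAL-TIME walkers, by ONE reduction to the pseudorandomness of the scheduled product ensemble
`schedEval Λ P` (`(n, K, i·x) ↦ F_{kᵢ}(x)`; vocabulary `KowPhVocabulary` p155137, programs `KowPhPrograms`).

Target `PrfHybridSoundness` (§2): for every `Λ`, `P` with `FP` schedules,
* (i) REDUCTION: for every PPT oracle adversary `𝒜` of the black-box walk game there is a PPT Boolean oracle adversary
  `ℬ` such that, in stage 6's admissible region (`2d+3 ≤ μ`, `d+8 ≤ μ`, round budget `≤ 2^{d/6}`),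
  `walkSuccessProb Λ P 𝒜 n ≤ 38·2^{-d/6} + 2^{2d+4}/2^μ + prfAdvantage (schedEval Λ P) (4·kpl) (μ+2) μ ℬ n`;
* (ii) ASYMPTOTIC: `SchedPRF Λ P` (the scheduled product ensemble is a PRF) and admissible schedules (depth eventually
  above `n^ε`, eventually no truncation / domain separation, negligible tag gap) imply `BlackBoxClauseC Λ P` — clause
  (C) of `WbwThesis` for every PPT walker using the instance `gen s` as a black box.

The reduction `ℬ` is ONE oracle machine of the transcript model: the walker wrapper (`stub_outer`) run over layer C
(`stub_walkSem`, `stub_walkFPQ`, `stub_walkFPOut`: walk requests over primitive requests) run over layer B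
(`stub_primSem`, `stub_primFP`: SIV encryption / recognition / keyed Feistel permutations over table lookups), each
layer an adaptive transducer (`stub_transducer`), composed by `OracleAlg.exists_polyTime_subroutine` (`stub_reduction`,
the lead's); its games are the real walk game (`stub_gameReal`, through `stub_codeLink`) and the ideal-II walk game
(`stub_gameIdeal`), which stage 6 bounds (`stub_bridge`).
-/

set_option linter.dupNamespace false

noncomputable section

namespace Summit.QuantumAdvantage.QuantumAdvantage.Cruxes.WbwObfuscatedGluedTrees.KnowledgeOfWalkSplit.PrfHybrid

open Literature.Computability.Complexity Literature.Computability.QuantumComplexity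
open Literature.Computability.QuantumComplexity.GluedTrees
open Literature.Computability.Cryptography Literature.Computability.Cryptography.ObfuscatedGluedTrees
open Summit.QuantumAdvantage.QuantumAdvantage.Theorems.WbwObfuscatedGluedTrees.KnowledgeOfWalk.BlackBox
open Summit.QuantumAdvantage.QuantumAdvantage.Theorems.WbwObfuscatedGluedTrees.KnowledgeOfWalk.RealIdeal
open Summit.QuantumAdvantage.QuantumAdvantage.Theorems.WbwObfuscatedGluedTrees.KnowledgeOfWalk.PrfHybrid
open Literature.Computability.Complexity.CodeFP (unE pairE strE listE)
open _root_.Computability Filter Asymptotics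

/-! ## §1 The eleven stubs — all LANDED as their own files under `Theorems/WbwObfuscatedGluedTreesKowPh*.lean`
## (`stub_transducer` p157061, `stub_primSem` p157469, `stub_primFP` p158507, `stub_walkSem` p160519 (+ aux p159882),
## `stub_walkFPQ` p161142, `stub_walkFPOut` p161537, `stub_outer` p162329, `stub_reduction` — assembled from the seven
## preceding ones — p162795, `stub_gameReal` p162738, `stub_gameIdeal` p163068, `stub_bridge` p162983); the composition below consumes the last four BY NAME,
## their statements being the aliases `Registered.stub_*` (textually the registered stubs). -/

/-! ### Name-keyed aliases of the four statements the composition consumes (textually the registered stubs) -/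
namespace Registered

/-- Statement of `stub_reduction`. -/
abbrev stub_reduction : Prop :=
  ∀ (Λ : Params) (𝒜 : OracleAdversary (List Bool)),
    CodeFP unE unE Λ.prfParam → CodeFP unE unE Λ.depth →
    (∃ p : Polynomial ℕ, ∀ n, Λ.prfParam n ≤ p.eval n ∧ Λ.depth n ≤ p.eval n) →
    𝒜.IsPPT (encodingList Bool) →
    ∃ ℬ : OracleAdversary Bool, ℬ.IsPPT encodingBoolBool ∧ ℬ.coins = 𝒜.coins ∧
      ∀ (n : ℕ) (O : Oracle) (r : List Bool), r.length = 𝒜.coins.eval (gameInput n).length →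
        ℬ.alg.run O (ℬ.fuel.eval (gameInput n).length) (boolPair (gameInput n) r) =
          some (decide (WalkWin 𝒜.alg (𝒜.fuel.eval (gameInput n).length) (boolPair (gameInput n) r)
            (codeCycle (tabOf (Λ.prfParam n) O) (Λ.depth n)) (codeNaming (tabOf (Λ.prfParam n) O) (Λ.depth n))))

/-- Statement of `stub_gameReal`. -/
abbrev stub_gameReal : Prop :=
  ∀ (Λ : Params) (P : PuncturablePRFScheme) (𝒜 : OracleAdversary (List Bool)) (ℬ : OracleAdversary Bool) (n : ℕ),
    labelLen (Λ.depth n) ≤ Λ.prfParam n → Λ.depth n ≤ Λ.prfParam n → ℬ.coins = 𝒜.coins →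
    (∀ (O : Oracle) (r : List Bool), r.length = 𝒜.coins.eval (gameInput n).length →
        ℬ.alg.run O (ℬ.fuel.eval (gameInput n).length) (boolPair (gameInput n) r) =
          some (decide (WalkWin 𝒜.alg (𝒜.fuel.eval (gameInput n).length) (boolPair (gameInput n) r)
            (codeCycle (tabOf (Λ.prfParam n) O) (Λ.depth n)) (codeNaming (tabOf (Λ.prfParam n) O) (Λ.depth n))))) →
    prfRealProb (schedEval Λ P) (fun n => 4 * Λ.keyPartLen n) (fun n => Λ.prfParam n + 2) ℬ n =
      walkSuccessProb Λ P 𝒜 n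

/-- Statement of `stub_gameIdeal`. -/
abbrev stub_gameIdeal : Prop :=
  ∀ (Λ : Params) (𝒜 : OracleAdversary (List Bool)) (ℬ : OracleAdversary Bool) (n : ℕ), ℬ.coins = 𝒜.coins →
    (∀ (O : Oracle) (r : List Bool), r.length = 𝒜.coins.eval (gameInput n).length →
        ℬ.alg.run O (ℬ.fuel.eval (gameInput n).length) (boolPair (gameInput n) r) =
          some (decide (WalkWin 𝒜.alg (𝒜.fuel.eval (gameInput n).length) (boolPair (gameInput n) r)
            (codeCycle (tabOf (Λ.prfParam n) O) (Λ.depth n)) (codeNaming (tabOf (Λ.prfParam n) O) (Λ.depth n))))) →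
    prfIdealProb (fun n => Λ.prfParam n + 2) Λ.prfParam ℬ n =
      idealWalkSuccessProb (Λ.depth n) (Λ.prfParam n) 𝒜.alg (𝒜.fuel.eval (gameInput n).length) (gameInput n)
        (𝒜.coins.eval (gameInput n).length)

/-- Statement of `stub_bridge`. -/
abbrev stub_bridge : Prop :=
  ∀ (d μ : ℕ) (A : OracleAlg (List Bool)) (k : ℕ) (x : List Bool) (c : ℕ) (B : ℝ),
    (∀ (M : OracleAlg (List Bool)) (x' : List Bool), codeSuccessProb d μ M x' k ≤ B) →
    idealWalkSuccessProb d μ A k x c ≤ B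

end Registered

/-! ## §2 The target of stage 7 and its composition BY NAME -/

/-- **Stage-7 target: the PRF hybrid.** (i) REDUCTION: for every PPT black-box walker there is ONE PPT distinguisher of
the scheduled product ensemble whose PRF advantage, added to stage 6's ideal-II bound, dominates the walker's real
success probability throughout the admissible region; (ii) ASYMPTOTIC: pseudorandomness of the scheduled product
ensemble and admissible schedules give black-box clause (C) for the landed generator. -/
def PrfHybridSoundness : Prop :=
  ∀ (Λ : Params) (P : PuncturablePRFScheme),
    CodeFP unE unE Λ.prfParam → CodeFP unE unE Λ.depth →
    (∃ p : Polynomial ℕ, ∀ n, Λ.prfParam n ≤ p.eval n ∧ Λ.depth n ≤ p.eval n) →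
    (∀ 𝒜 : OracleAdversary (List Bool), 𝒜.IsPPT (encodingList Bool) →
      ∃ ℬ : OracleAdversary Bool, ℬ.IsPPT encodingBoolBool ∧
        ∀ n : ℕ, labelLen (Λ.depth n) ≤ Λ.prfParam n → Λ.depth n + 8 ≤ Λ.prfParam n →
          ((𝒜.fuel.eval (gameInput n).length : ℕ) : ℝ) ≤ (2 : ℝ) ^ (((Λ.depth n : ℕ) : ℝ) / 6) →
          walkSuccessProb Λ P 𝒜 n ≤
            38 * (2 : ℝ) ^ (-(((Λ.depth n : ℕ) : ℝ) / 6)) + (2 : ℝ) ^ (2 * Λ.depth n + 4) / 2 ^ Λ.prfParam n +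
              prfAdvantage (schedEval Λ P) (fun n => 4 * Λ.keyPartLen n) (fun n => Λ.prfParam n + 2) Λ.prfParam ℬ n) ∧
    (SchedPRF Λ P →
      (∃ ε : ℝ, 0 < ε ∧ ∀ᶠ n : ℕ in atTop, (n : ℝ) ^ ε ≤ Λ.depth n) →
      (∀ᶠ n : ℕ in atTop, labelLen (Λ.depth n) ≤ Λ.prfParam n ∧ Λ.depth n + 8 ≤ Λ.prfParam n) →
      SuperpolynomialDecay atTop (fun n : ℕ => (n : ℝ)) (fun n => (2 : ℝ) ^ (2 * Λ.depth n + 4) / 2 ^ Λ.prfParam n) →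
      BlackBoxClauseC Λ P)

/-- The real success probability is non-negative. [folklore] -/
theorem walkSuccessProb_nonneg (Λ : Params) (P : PuncturablePRFScheme) (𝒜 : OracleAdversary (List Bool)) (n : ℕ) :
    0 ≤ walkSuccessProb Λ P 𝒜 n := by
  unfold walkSuccessProb; positivity

/-- **Conjunct (i) from the reduction, the two games and the bridge** (the statements of `stub_reduction`,
`stub_gameReal`, `stub_gameIdeal`, `stub_bridge` as hypotheses; stage 6 enters through `idealCode_numeric`). -/
theorem partI_of (hR : Registered.stub_reduction) (hGR : Registered.stub_gameReal)
    (hGI : Registered.stub_gameIdeal) (hB : Registered.stub_bridge)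
    (Λ : Params) (P : PuncturablePRFScheme) (hμFP : CodeFP unE unE Λ.prfParam) (hdFP : CodeFP unE unE Λ.depth)
    (hpoly : ∃ p : Polynomial ℕ, ∀ n, Λ.prfParam n ≤ p.eval n ∧ Λ.depth n ≤ p.eval n)
    (𝒜 : OracleAdversary (List Bool)) (h𝒜 : 𝒜.IsPPT (encodingList Bool)) :
    ∃ ℬ : OracleAdversary Bool, ℬ.IsPPT encodingBoolBool ∧
      ∀ n : ℕ, labelLen (Λ.depth n) ≤ Λ.prfParam n → Λ.depth n + 8 ≤ Λ.prfParam n →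
        ((𝒜.fuel.eval (gameInput n).length : ℕ) : ℝ) ≤ (2 : ℝ) ^ (((Λ.depth n : ℕ) : ℝ) / 6) →
        walkSuccessProb Λ P 𝒜 n ≤
          38 * (2 : ℝ) ^ (-(((Λ.depth n : ℕ) : ℝ) / 6)) + (2 : ℝ) ^ (2 * Λ.depth n + 4) / 2 ^ Λ.prfParam n +
            prfAdvantage (schedEval Λ P) (fun n => 4 * Λ.keyPartLen n) (fun n => Λ.prfParam n + 2) Λ.prfParam ℬ n := by
  obtain ⟨ℬ, hℬ, hcoins, hsim⟩ := hR Λ 𝒜 hμFP hdFP hpoly h𝒜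
  refine ⟨ℬ, hℬ, fun n hμ hμ' ht => ?_⟩
  have hreal := hGR Λ P 𝒜 ℬ n hμ (by unfold labelLen at hμ; omega) hcoins (hsim n)
  have hideal := hGI Λ 𝒜 ℬ n hcoins (hsim n)
  -- stage 6 bounds the ideal-II walk game
  have hbound : idealWalkSuccessProb (Λ.depth n) (Λ.prfParam n) 𝒜.alg (𝒜.fuel.eval (gameInput n).length)
      (gameInput n) (𝒜.coins.eval (gameInput n).length) ≤
      38 * (2 : ℝ) ^ (-(((Λ.depth n : ℕ) : ℝ) / 6)) + (2 : ℝ) ^ (2 * Λ.depth n + 4) / 2 ^ Λ.prfParam n :=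
    hB _ _ _ _ _ _ _ fun M x' =>
      Summit.QuantumAdvantage.QuantumAdvantage.Cruxes.WbwObfuscatedGluedTrees.KnowledgeOfWalkSplit.RealIdeal.idealCode_numeric
        _ _ M x' _ (Λ.depth_pos n) hμ hμ' ht
  -- real ≤ ideal + |real − ideal|
  have hadv : prfRealProb (schedEval Λ P) (fun n => 4 * Λ.keyPartLen n) (fun n => Λ.prfParam n + 2) ℬ n ≤
      prfIdealProb (fun n => Λ.prfParam n + 2) Λ.prfParam ℬ n +
        prfAdvantage (schedEval Λ P) (fun n => 4 * Λ.keyPartLen n) (fun n => Λ.prfParam n + 2) Λ.prfParam ℬ n := by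
    unfold prfAdvantage
    have := le_abs_self (prfRealProb (schedEval Λ P) (fun n => 4 * Λ.keyPartLen n) (fun n => Λ.prfParam n + 2) ℬ n -
      prfIdealProb (fun n => Λ.prfParam n + 2) Λ.prfParam ℬ n)
    linarith
  rw [← hreal]
  rw [hideal] at hadv
  linarith

/-- **Conjunct (ii) from conjunct (i)**: pseudorandomness makes the distinguisher's advantage negligible, admissible
schedules put every polynomial round budget in the region eventually and make stage 6's bound negligible. -/
theorem partII_of (Λ : Params) (P : PuncturablePRFScheme)
    (hI : ∀ 𝒜 : OracleAdversary (List Bool), 𝒜.IsPPT (encodingList Bool) →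
      ∃ ℬ : OracleAdversary Bool, ℬ.IsPPT encodingBoolBool ∧
        ∀ n : ℕ, labelLen (Λ.depth n) ≤ Λ.prfParam n → Λ.depth n + 8 ≤ Λ.prfParam n →
          ((𝒜.fuel.eval (gameInput n).length : ℕ) : ℝ) ≤ (2 : ℝ) ^ (((Λ.depth n : ℕ) : ℝ) / 6) →
          walkSuccessProb Λ P 𝒜 n ≤
            38 * (2 : ℝ) ^ (-(((Λ.depth n : ℕ) : ℝ) / 6)) + (2 : ℝ) ^ (2 * Λ.depth n + 4) / 2 ^ Λ.prfParam n +
              prfAdvantage (schedEval Λ P) (fun n => 4 * Λ.keyPartLen n) (fun n => Λ.prfParam n + 2) Λ.prfParam ℬ n)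
    (hPRF : SchedPRF Λ P) {ε : ℝ} (hε : 0 < ε) (hdep : ∀ᶠ n : ℕ in atTop, (n : ℝ) ^ ε ≤ Λ.depth n)
    (hμ : ∀ᶠ n : ℕ in atTop, labelLen (Λ.depth n) ≤ Λ.prfParam n ∧ Λ.depth n + 8 ≤ Λ.prfParam n)
    (hgap : SuperpolynomialDecay atTop (fun n : ℕ => (n : ℝ))
      (fun n => (2 : ℝ) ^ (2 * Λ.depth n + 4) / 2 ^ Λ.prfParam n)) :
    BlackBoxClauseC Λ P := by
  intro 𝒜 h𝒜
  obtain ⟨ℬ, hℬ, hle⟩ := hI 𝒜 h𝒜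
  have hadv : SuperpolynomialDecay atTop (fun n : ℕ => (n : ℝ))
      (prfAdvantage (schedEval Λ P) (fun n => 4 * Λ.keyPartLen n) (fun n => Λ.prfParam n + 2) Λ.prfParam ℬ) :=
    hPRF.2 ℬ hℬ
  have hbnd := Summit.QuantumAdvantage.QuantumAdvantage.Cruxes.WbwObfuscatedGluedTrees.KnowledgeOfWalkSplit.RealIdeal.superpolynomialDecay_bound
    hε hdep hgap
  have hlen : ∀ n : ℕ, (gameInput n).length = n := fun n => by simp [gameInput]
  refine (hbnd.add hadv).trans_eventually_abs_le ?_
  filter_upwards [hμ, Summit.QuantumAdvantage.QuantumAdvantage.Cruxes.WbwObfuscatedGluedTrees.KnowledgeOfWalkSplit.RealIdeal.eventually_natPoly_le_two_rpow_depth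
    hε hdep 𝒜.fuel] with n hn ht
  have ht' : ((𝒜.fuel.eval (gameInput n).length : ℕ) : ℝ) ≤ (2 : ℝ) ^ (((Λ.depth n : ℕ) : ℝ) / 6) := by
    rw [hlen]; exact ht
  have h := hle n hn.1 hn.2 ht'
  have h0 := walkSuccessProb_nonneg Λ P 𝒜 n
  have h1 : 0 ≤ prfAdvantage (schedEval Λ P) (fun n => 4 * Λ.keyPartLen n) (fun n => Λ.prfParam n + 2) Λ.prfParam ℬ n :=
    prfAdvantage_nonneg _ _ _ _ _ _
  simp only [Function.comp_apply, Pi.add_apply]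
  rw [abs_of_nonneg h0, abs_of_nonneg (by positivity)]
  simpa [add_assoc] using h

/-- **Composition: the registered stubs give the stage-7 target BY NAME.** -/
theorem WbwObfuscatedGluedTrees_of (hR : Registered.stub_reduction) (hGR : Registered.stub_gameReal)
    (hGI : Registered.stub_gameIdeal) (hB : Registered.stub_bridge) :
    PrfHybridSoundness := by
  intro Λ P hμFP hdFP hpoly
  have hI := partI_of hR hGR hGI hB Λ P hμFP hdFP hpoly
  refine ⟨hI, fun hPRF hdep hμ hgap => ?_⟩
  obtain ⟨ε, hε, hdep⟩ := hdep
  exact partII_of Λ P hI hPRF hε hdep hμ hgap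

/-- **The stage-7 target holds**: the composition fed with the LANDED stubs (§1) by name. -/
theorem prfHybridSoundness_holds : PrfHybridSoundness :=
  WbwObfuscatedGluedTrees_of
    Summit.QuantumAdvantage.QuantumAdvantage.Theorems.WbwObfuscatedGluedTrees.KnowledgeOfWalk.PrfHybrid.stub_reduction
    Summit.QuantumAdvantage.QuantumAdvantage.Theorems.WbwObfuscatedGluedTrees.KnowledgeOfWalk.PrfHybrid.stub_gameReal
    Summit.QuantumAdvantage.QuantumAdvantage.Theorems.WbwObfuscatedGluedTrees.KnowledgeOfWalk.PrfHybrid.stub_gameIdeal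
    Summit.QuantumAdvantage.QuantumAdvantage.Theorems.WbwObfuscatedGluedTrees.KnowledgeOfWalk.PrfHybrid.stub_bridge

end Summit.QuantumAdvantage.QuantumAdvantage.Cruxes.WbwObfuscatedGluedTrees.KnowledgeOfWalkSplit.PrfHybrid

end
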